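import Summits.BirchSwinnertonDyer.BirchSwinnertonDyer.Theorems.ThetaPartnerAtTwoSignedTransportAtTwoFrobeniusTwoTorsion
import Literature.NumberTheory.EllipticCurves.PrimaryTorsionFrobeniusUnramifiedProofs
import Literature.NumberTheory.EllipticCurves.LFunctionPrimeCoeff
import Literature.NumberTheory.EllipticCurves.NonvanishingTwistsWaldspurgerOfHoffsteinLuo
import Literature.NumberTheory.EllipticCurves.BSDConductorProofs
import Summits.BirchSwinnertonDyer.BirchSwinnertonDyer.Theorems.ResidualThetaTransportAtTwoThetaLayerLambdaCongruenceAtTwoResidualReduction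
import Summits.BirchSwinnertonDyer.BirchSwinnertonDyer.Theorems.ResidualThetaTransportAtTwoThetaLayerLambdaCongruenceAtTwoDoubling
import HarnessLib

/-!
# Crux `MazurTateCongruenceAtTwoTop` (stmt-BirchSwinnertonDyer-25797 = 21416), line `symbol`: the TRACE CONGRUENCE
# `a_q(W) ≡ a_q(A) (mod 2)` at every common good prime, FROM THE CRUX'S OWN BINDER `W[2] ≃ A[2]` (equivariant)
# (lead prover bsd-wall-tp2-p1 g10; `--supports 25797`)

HONEST FRAMING. THEOREMS ONLY. This discharges the hypothesis `hcong` of the plus-line bridge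
(`…ROfPlusLine.depletedParity_of_congruent_of_facts`, `…ROfPlusLineList.parity_cusps_of_congruent_of_facts`) from data the
crux already binds: a Galois-equivariant `W[2] ≃+ A[2]` and good supersingular reduction of both curves at `2`. BSD is not proved
by any of this.

WHAT. (§1) For a good odd place `v` of both curves, `a_v(W)` even and `a_v(A)` odd is impossible: a local Frobenius `σ` is an
involution on `W[2]` when `a_v(W)` is even (`smul_smul_eq_self_of_even`), hence — transported through the equivariant `e` — on
`A[2]`, while for `a_v(A)` odd `σ²` fixes no non-zero point of `A[2]` (`eq_zero_of_pow_two_pow_smul_eq_of_odd`), and `#A[2] = 4`.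
So `a_v(W) ≡ a_v(A) (mod 2)` (`even_frobeniusTraceAt_sub_of_equiv`), prime-indexed `even_frobeniusTrace_sub_of_equiv`.
(§2) With both curves good supersingular at `2` (`2 ∣ a_2`): `‖a_q(A) − a_q(W)‖ < 1` in `ℚ̄₂` at every prime `q ∤ N_W N_A`
(`norm_LFunction_sub_lt_one_of_equiv`; `‖2‖ < 1`, `‖ℤ‖ ≤ 1` reused from `ThetaLayerLambdaCongruenceAtTwo`) — literally the `hcong` of the bridge.

References: [DarmonDiamondTaylor1995] Prop. 2.11 (a); [SilvermanAEC2009] III.6.4, VII.1.3; [Silverman1994] IV.10.2(a).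
-/

set_option linter.dupNamespace false
set_option autoImplicit false

noncomputable section

open scoped Classical

open NumberField IsDedekindDomain Field Rat.HeightOneSpectrum WeierstrassCurve
open Literature.NumberTheory.GaloisRepresentations Literature.NumberTheory.EllipticCurves
open Summit.BirchSwinnertonDyer.BirchSwinnertonDyer.Theorems.SignedTransportAtTwo

namespace Summit.BirchSwinnertonDyer.BirchSwinnertonDyer.Theorems.MazurTateCongruenceAtTwoR

/-! ## §1. Parity of Frobenius traces from an equivariant `W[2] ≃ A[2]` -/

section Parity

variable (W A : WeierstrassCurve ℚ) [W.IsElliptic] [W.IsGloballyMinimal] [A.IsElliptic] [A.IsGloballyMinimal]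

/-- **`a_v(W)` even and `a_v(A)` odd is impossible when `W[2] ≃ A[2]` equivariantly** (`v` a good odd place of both): an even
trace makes a local Frobenius an involution on `W[2]`, hence on `A[2]`; an odd trace lets its square fix only `0`; `#A[2] = 4`.
[cite: DarmonDiamondTaylor1995, Prop. 2.11 (a)] [cite: SilvermanAEC2009, Cor. III.6.4(b)] -/
theorem not_odd_frobeniusTraceAt_of_even_of_equiv (e : geomTorsion W (2 : ℤ) ≃+ geomTorsion A (2 : ℤ))
    (he : ∀ (σ : absoluteGaloisGroup ℚ) (P : geomTorsion W (2 : ℤ)), e (σ • P) = σ • e P)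
    (v : HeightOneSpectrum (𝓞 ℚ)) (hv2 : ((2 : ℕ) : 𝓞 ℚ) ∉ v.asIdeal) (hW : W.HasGoodReductionAt v)
    (hA : A.HasGoodReductionAt v) (heven : Even (W.frobeniusTraceAt v)) : ¬ Odd (A.frobeniusTraceAt v) := by
  intro hodd
  obtain ⟨φ, hφ⟩ := exists_isFrobPow_one_adicCompletion (K := ℚ) v
  have hfix : ∀ Q : geomTorsion A ((2 : ℕ) : ℤ), Q = 0 := by
    intro Q
    refine eq_zero_of_pow_two_pow_smul_eq_of_odd A v hv2 hA hodd hφ 1 Q ?_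
    have hP := smul_smul_eq_self_of_even W v hv2 hW heven hφ (e.symm Q)
    have hQ := congrArg e hP
    rw [he, he, e.apply_symm_apply] at hQ
    rw [pow_one, pow_two, mul_smul]
    exact hQ
  haveI : Finite (geomTorsion A ((2 : ℕ) : ℤ)) :=
    finite_torsionPoints_holds A (AlgebraicClosure ℚ) (n := ((2 : ℕ) : ℤ)) (by norm_num)
  have hcard : Nat.card (geomTorsion A ((2 : ℕ) : ℤ)) = 2 ^ 2 :=
    card_torsionPoints_eq_sq_holds A (AlgebraicClosure ℚ) (n := 2) two_ne_zero
  have hnt : Nontrivial (geomTorsion A ((2 : ℕ) : ℤ)) :=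
    Finite.one_lt_card_iff_nontrivial.mp (by rw [hcard]; norm_num)
  obtain ⟨Q, hQ⟩ := exists_ne (0 : geomTorsion A ((2 : ℕ) : ℤ))
  exact hQ (hfix Q)

omit [W.IsElliptic] [W.IsGloballyMinimal] [A.IsElliptic] [A.IsGloballyMinimal] in
/-- The inverse of an equivariant `W[2] ≃+ A[2]` is equivariant. [folklore] -/
theorem symm_equivariant (e : geomTorsion W (2 : ℤ) ≃+ geomTorsion A (2 : ℤ))
    (he : ∀ (σ : absoluteGaloisGroup ℚ) (P : geomTorsion W (2 : ℤ)), e (σ • P) = σ • e P)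
    (σ : absoluteGaloisGroup ℚ) (Q : geomTorsion A (2 : ℤ)) : e.symm (σ • Q) = σ • e.symm Q := by
  apply e.injective
  rw [e.apply_symm_apply, he, e.apply_symm_apply]

/-- **`a_v(W) ≡ a_v(A) (mod 2)` at a good odd place `v` of both, when `W[2] ≃ A[2]` equivariantly.**
[cite: DarmonDiamondTaylor1995, Prop. 2.11 (a)] [cite: SilvermanAEC2009, Cor. III.6.4(b)] -/
theorem even_frobeniusTraceAt_sub_of_equiv (e : geomTorsion W (2 : ℤ) ≃+ geomTorsion A (2 : ℤ))
    (he : ∀ (σ : absoluteGaloisGroup ℚ) (P : geomTorsion W (2 : ℤ)), e (σ • P) = σ • e P)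
    (v : HeightOneSpectrum (𝓞 ℚ)) (hv2 : ((2 : ℕ) : 𝓞 ℚ) ∉ v.asIdeal) (hW : W.HasGoodReductionAt v)
    (hA : A.HasGoodReductionAt v) : Even (W.frobeniusTraceAt v - A.frobeniusTraceAt v) := by
  rcases Int.even_or_odd (W.frobeniusTraceAt v) with h₁ | h₁ <;>
    rcases Int.even_or_odd (A.frobeniusTraceAt v) with h₂ | h₂
  · exact h₁.sub h₂
  · exact absurd h₂ (not_odd_frobeniusTraceAt_of_even_of_equiv W A e he v hv2 hW hA h₁)
  · exact absurd h₁
      (not_odd_frobeniusTraceAt_of_even_of_equiv A W e.symm (symm_equivariant W A e he) v hv2 hA hW h₂)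
  · exact h₁.sub_odd h₂

/-- **`a_q(W) ≡ a_q(A) (mod 2)` at every odd prime `q ∤ N_W`, `q ∤ N_A`, when `W[2] ≃ A[2]` equivariantly** (prime-indexed
traces of the global minimal models). [cite: DarmonDiamondTaylor1995, Prop. 2.11 (a)] [cite: Silverman1994, IV.10.2(a)] -/
theorem even_frobeniusTrace_sub_of_equiv (e : geomTorsion W (2 : ℤ) ≃+ geomTorsion A (2 : ℤ))
    (he : ∀ (σ : absoluteGaloisGroup ℚ) (P : geomTorsion W (2 : ℤ)), e (σ • P) = σ • e P)
    {q : ℕ} (hq : q.Prime) (hq2 : q ≠ 2) (hW : ¬ q ∣ W.conductorNorm ℤ) (hA : ¬ q ∣ A.conductorNorm ℤ) :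
    Even (W.frobeniusTrace q - A.frobeniusTrace q) := by
  set v : HeightOneSpectrum (𝓞 ℚ) := primesEquiv.symm ⟨q, hq⟩ with hv
  have hvq : (primesEquiv v : ℕ) = q := by rw [hv, Equiv.apply_symm_apply]
  have hv2 : ((2 : ℕ) : 𝓞 ℚ) ∉ v.asIdeal := by
    intro h
    have h' := (natCast_mem_asIdeal_iff_eq_primesEquiv_symm v Nat.prime_two).mp h
    have h'' := congrArg (fun w : HeightOneSpectrum (𝓞 ℚ) ↦ (primesEquiv w : ℕ)) h'
    simp only [hvq, Equiv.apply_symm_apply] at h''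
    exact hq2 h''
  have hgW : W.HasGoodReductionAt v := hasGoodReductionAt_of_not_dvd_conductorNorm W v (by rwa [hvq])
  have hgA : A.HasGoodReductionAt v := hasGoodReductionAt_of_not_dvd_conductorNorm A v (by rwa [hvq])
  have h := even_frobeniusTraceAt_sub_of_equiv W A e he v hv2 hgW hgA
  rwa [frobeniusTraceAt_eq_frobeniusTrace, frobeniusTraceAt_eq_frobeniusTrace, hvq] at h

end Parity

/-! ## §2. The trace congruence `‖a_q(A) − a_q(W)‖ < 1` in `ℚ̄₂` (the bridge's `hcong`) -/

section Norm

variable (W A : WeierstrassCurve ℚ) [W.IsElliptic] [W.IsGloballyMinimal] [A.IsElliptic] [A.IsGloballyMinimal]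

/-- **The trace congruence of the plus-line bridge, from `W[2] ≃ A[2]`**: for globally minimal elliptic `W`, `A` over `ℚ`, both
good supersingular at `2`, with a Galois-equivariant `W[2] ≃+ A[2]`, and every prime `q ∤ N_W`, `q ∤ N_A`:
`‖a_q(A) − a_q(W)‖ < 1` in `ℚ̄₂` (`a_q = W.LFunction q`, the `q`-th Dirichlet coefficient; at `q = 2` both are even, at odd `q`
§1 applies). This is literally hypothesis `hcong` of `depletedParity_of_congruent_of_facts` / `parity_cusps_of_congruent_of_facts`.
[cite: DarmonDiamondTaylor1995, Prop. 2.11 (a)] [cite: SilvermanAEC2009, Exercise 8.19(a)] -/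
theorem norm_LFunction_sub_lt_one_of_equiv (e : geomTorsion W (2 : ℤ) ≃+ geomTorsion A (2 : ℤ))
    (he : ∀ (σ : absoluteGaloisGroup ℚ) (P : geomTorsion W (2 : ℤ)), e (σ • P) = σ • e P)
    (hss : Rank1Residual.GoodSS W 2) (hssA : Rank1Residual.GoodSS A 2)
    {q : ℕ} (hq : q.Prime) (hW : ¬ q ∣ W.conductorNorm ℤ) (hA : ¬ q ∣ A.conductorNorm ℤ) :
    ‖(A.LFunction q : PadicAlgCl 2) - (W.LFunction q : PadicAlgCl 2)‖ < 1 := by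
  obtain ⟨v, rfl⟩ : ∃ v : HeightOneSpectrum (𝓞 ℚ), (primesEquiv v : ℕ) = q :=
    ⟨primesEquiv.symm ⟨q, hq⟩, by rw [Equiv.apply_symm_apply]⟩
  haveI : Fact (Nat.Prime (primesEquiv v : ℕ)) := ⟨(primesEquiv v).2⟩
  have hgW : W.HasGoodReductionAtPrime (primesEquiv v : ℕ) :=
    (hasGoodReductionAtPrime_iff_hasGoodReductionAt_ringOfIntegers v W).mpr
      (hasGoodReductionAt_of_not_dvd_conductorNorm W v hW)
  have hgA : A.HasGoodReductionAtPrime (primesEquiv v : ℕ) :=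
    (hasGoodReductionAtPrime_iff_hasGoodReductionAt_ringOfIntegers v A).mpr
      (hasGoodReductionAt_of_not_dvd_conductorNorm A v hA)
  rw [LFunction_apply_prime_eq_frobeniusTrace A _ hgA, LFunction_apply_prime_eq_frobeniusTrace W _ hgW]
  have heven : Even (A.frobeniusTrace (primesEquiv v : ℕ) - W.frobeniusTrace (primesEquiv v : ℕ)) := by
    by_cases hq2 : (primesEquiv v : ℕ) = 2
    · rw [hq2]
      exact (even_iff_two_dvd.mpr hssA.2).sub (even_iff_two_dvd.mpr hss.2)
    · exact even_frobeniusTrace_sub_of_equiv A W e.symm (symm_equivariant W A e he) hq hq2 hA hW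
  obtain ⟨k, hk⟩ := heven
  have hcast : ((A.frobeniusTrace (primesEquiv v : ℕ) : ℤ) : PadicAlgCl 2) -
      ((W.frobeniusTrace (primesEquiv v : ℕ) : ℤ) : PadicAlgCl 2) = (2 : PadicAlgCl 2) * (k : PadicAlgCl 2) := by
    rw [← Int.cast_sub, hk, ← two_mul, Int.cast_mul, Int.cast_ofNat]
  rw [hcast, norm_mul]
  exact mul_lt_one_of_nonneg_of_lt_one_left (norm_nonneg _) ThetaLayerLambdaCongruenceAtTwo.norm_two_padicAlgCl_lt_one
    (ThetaLayerLambdaCongruenceAtTwo.norm_intCast_padicAlgCl_two_le_one k)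

end Norm

end Summit.BirchSwinnertonDyer.BirchSwinnertonDyer.Theorems.MazurTateCongruenceAtTwoR

end
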